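import Literature.Barriers.QuantumFields.NoClassicalGlueballsTraceForm
import Literature.Barriers.QuantumFields.NoClassicalGlueballsInversionalLawProofs
import Literature.Barriers.QuantumFields.NoClassicalGlueballsFluxPositivityProofs
import Literature.Barriers.QuantumFields.NoClassicalGlueballsConeEstimateProofs
import HarnessLib

/-!
# Decay of classical Yang–Mills fields: the Glassey–Strauss theorem (proof of the named fact)

Sibling proof file of `Literature/Barriers/QuantumFields/NoClassicalGlueballs.lean` (barrier
catalogue D-0021, summit `QuantumFields`). It discharges the named fact
`GlasseyStraussLocalEnergyDecay` (Glassey–Strauss, CMP 65 (1979), §4 **Theorem**, p. 7: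
"Let `R > 0` and `0 < ε ≤ 1`. Then `∫_{|x| ≤ R+(1−ε)t} [½|E|² + ½|H|²] dx = O(t⁻²)` as `t → ∞`.
This is valid for solutions whose Cauchy data (at any time) satisfies `∫ r² e(E,H) dx < ∞`.")
as `GlasseyStraussLocalEnergyDecay_holds`, by assembling the sibling files:

1. `NoClassicalGlueballsStressTensor` / `…TraceForm`: the stress tensor `θ_{μν}` of the field for
   the invariant form `B = Re tr(Xᴴ Y)` on `𝔰𝔲(2) ⊆ M₂(ℂ)` (`isInvariantForm_traceFormL_suAlgebra`),
   `θ₀₀ = e = ½|E|² + ½|H|²` (`stressTensor_zero_zero`), `∂^μ θ_{μν} = 0`;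
2. `…ConformalCurrent` / `…InversionalLawProofs`: the inversional current `J^μ = η^{μμ} Σ_ν θ_{μν} K^ν`,
   `K = ((t−t₀)² + r²)∂₀ + 2(t−t₀)xⁱ∂ᵢ`, with `∂_μ J^μ = 0` (Glassey–Strauss (13)) in the chart
   `(t, y)` (`conformalCurrent_conservation_chart`) and `J⁰(t₀, y) = |y|² e(t₀, y)`;
3. `…FluxPositivityProofs`: `J⁰ ≥ (|t − t₀| − |y|)² e ≥ 0` (pointwise (15)) and the outgoing flux
   `0 ≤ ⟨y⟩ J⁰ + Σ y_j Jʲ` for `t ≥ t₀`;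
4. `…ConeEstimateProofs`: hence `∫_{|y| ≤ ρ} J⁰(t, y) dy ≤ ∫ J⁰(t₀, y) dy = ∫ r² e(t₀) dx =: C`
   for all `t ≥ t₀`, `ρ` (`setIntegral_closedBall_le_integral_of_flux`).

With `ρ = R + (1 − ε)t` and `t ≥ max(t₀, 2(R + |t₀|)/ε)`, on the ball `|t − t₀| − |y| ≥ εt/2`,
so `e ≤ 4 J⁰/(ε²t²)` there and `∫_{|y| ≤ R+(1−ε)t} e(t, y) dy ≤ 4C/(ε² t²)` — the printed proof
(p. 7: "`(εt − R)² ∫ … e dx ≤ const` for `t > Rε⁻¹`") with the constant made explicit. The main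
statement is proved for an arbitrary coefficient algebra and invariant form
(`glasseyStrauss_isBigO_of_invariantForm`) and then specialised to `𝔰𝔲(2)`.

Scope remark (recorded in the catalogue entry's `scope_caveats`): Glassey–Strauss integrate (13)
over all space assuming decay at infinity at all times; the fact as vendored assumes
`∫ r² e dx < ∞` at one time only, which the cone (domain-of-dependence) form of the argument in
step 4 handles. Nothing in the fact is weakened.

## References

* R. T. Glassey, W. A. Strauss, *Decay of classical Yang–Mills fields*, Commun. Math. Phys. 65
  (1979) 1–13, §3 (13), §4 Theorem (p. 7), (15) [GlasseyStrauss1979].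
* S. Coleman, *There are no classical glueballs*, Commun. Math. Phys. 55 (1977) 113–116
  [Coleman1977].
-/

noncomputable section

open MeasureTheory Set Filter Topology Function Metric Asymptotics
open scoped ContDiff Matrix Matrix.Norms.Frobenius

namespace Literature.Barriers.QuantumFields

open Literature.MathematicalPhysics.QuantumLattice Literature.MathematicalPhysics.QuantumFieldTheory
  Literature.Analysis.FluidPDE

/-! ### The decay estimate for an arbitrary invariant form -/

section Generic

variable {𝔸 : Type*} [NormedRing 𝔸] [NormedAlgebra ℝ 𝔸]
variable {𝔤 : Submodule ℝ 𝔸} {B : 𝔸 →L[ℝ] 𝔸 →L[ℝ] ℝ} {A : Connection (SpaceTime 3) 𝔸}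

/-- **The cone bound for the inversional charge (localised Glassey–Strauss (15)).** For a smooth
`𝔤`-valued solution of the Yang–Mills equations with `∫ |y|² e(t₀, y) dy < ∞`, for every `t ≥ t₀`
and `ρ`: `∫_{|y| ≤ ρ} J⁰(t, y) dy ≤ ∫ |y|² e(t₀, y) dy`. [cite: GlasseyStrauss1979, §4 (15)] -/
theorem setIntegral_conformalCurrent_le (hB : IsInvariantForm 𝔤 B) (h𝔤 : A.IsValuedIn 𝔤)
    (hA : IsSmoothConnection A) (hsol : IsMinkowskiYangMills A) {t₀ : ℝ}
    (hint : Integrable fun y : EuclideanSpace ℝ (Fin 3) => ‖y‖ ^ 2 * ymEnergyDensity A (ofTimeSpace t₀ y))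
    {t : ℝ} (ht : t₀ ≤ t) (ρ : ℝ) :
    ∫ y in closedBall (0 : EuclideanSpace ℝ (Fin 3)) ρ, conformalCurrent B A t₀ 0 (ofTimeSpace t y) ≤
      ∫ y : EuclideanSpace ℝ (Fin 3), ‖y‖ ^ 2 * ymEnergyDensity A (ofTimeSpace t₀ y) := by
  set q : ℝ → EuclideanSpace ℝ (Fin 3) → ℝ := fun s y => conformalCurrent B A t₀ 0 (ofTimeSpace s y)
    with hq
  set g : Fin 3 → ℝ → EuclideanSpace ℝ (Fin 3) → ℝ :=
    fun i s y => conformalCurrent B A t₀ i.succ (ofTimeSpace s y) with hg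
  have hqs : ContDiff ℝ ∞ (uncurry q) :=
    (contDiff_conformalCurrent (B := B) hA t₀ 0).comp contDiff_ofTimeSpace_uncurry
  have hgs : ∀ i, ContDiff ℝ ∞ (uncurry (g i)) := fun i =>
    (contDiff_conformalCurrent (B := B) hA t₀ i.succ).comp contDiff_ofTimeSpace_uncurry
  have hcons : ∀ s y, deriv (fun s' => q s' y) s +
      ∑ i, fderiv ℝ (g i s) y (EuclideanSpace.single i 1) = 0 := fun s y =>
    conformalCurrent_conservation_chart hB h𝔤 hA hsol t₀ s y
  have hpos : ∀ s, t₀ ≤ s → ∀ y : EuclideanSpace ℝ (Fin 3), 0 ≤ q s y := fun s _ y =>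
    conformalCurrent_zero_ofTimeSpace_nonneg hB A t₀ s y
  have hflux : ∀ s, t₀ ≤ s → ∀ y : EuclideanSpace ℝ (Fin 3),
      0 ≤ √(1 + ‖y‖ ^ 2) * q s y + ∑ i, y i * g i s y := fun s hs y =>
    conformalCurrent_flux_nonneg hB A hs y
  have he : q t₀ = fun y => ‖y‖ ^ 2 * ymEnergyDensity A (ofTimeSpace t₀ y) :=
    funext fun y => conformalCurrent_zero_ofTimeSpace_self A hB t₀ y
  have hint' : Integrable (q t₀) := by rw [he]; exact hint
  have h := setIntegral_closedBall_le_integral_of_flux hqs hgs hcons hpos hflux hint' ht ρ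
  rwa [he] at h

/-- **Glassey–Strauss local energy decay for an arbitrary invariant form.** For a smooth
`𝔤`-valued solution of the Yang–Mills equations on `ℝ^{1+3}` with `∫ |y|² e(t₀, y) dy < ∞` at
some time `t₀`, every `R` and every `ε > 0` (the printed hypotheses `R > 0`, `ε ≤ 1` are not
needed): `∫_{|y| ≤ R + (1−ε)t} e(t, y) dy = O(t⁻²)` as `t → ∞`;
explicitly `≤ 4C/(ε²t²)` for `t ≥ max(t₀, 2(R + |t₀|)/ε)`, `C = ∫ |y|² e(t₀, y) dy`, since on the
ball `(εt/2)² e ≤ (|t − t₀| − |y|)² e ≤ J⁰`. [cite: GlasseyStrauss1979, §4 Theorem (p. 7)] -/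
theorem glasseyStrauss_isBigO_of_invariantForm (hB : IsInvariantForm 𝔤 B) (h𝔤 : A.IsValuedIn 𝔤)
    (hA : IsSmoothConnection A) (hsol : IsMinkowskiYangMills A) (t₀ : ℝ)
    (hint : Integrable fun y : EuclideanSpace ℝ (Fin 3) => ‖y‖ ^ 2 * ymEnergyDensity A (ofTimeSpace t₀ y))
    (R : ℝ) (ε : ℝ) (hε : 0 < ε) :
    (fun t : ℝ => ∫ y in {y : EuclideanSpace ℝ (Fin 3) | ‖y‖ ≤ R + (1 - ε) * t},
        ymEnergyDensity A (ofTimeSpace t y)) =O[atTop] fun t : ℝ => (t ^ 2)⁻¹ := by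
  set C : ℝ := ∫ y : EuclideanSpace ℝ (Fin 3), ‖y‖ ^ 2 * ymEnergyDensity A (ofTimeSpace t₀ y) with hC
  refine IsBigO.of_bound (4 * C / ε ^ 2) ?_
  rw [eventually_atTop]
  refine ⟨max (max t₀ 1) (2 * (R + |t₀|) / ε), fun t ht => ?_⟩
  have ht₀ : t₀ ≤ t := le_trans (le_max_left _ _) ((le_max_left _ _).trans ht)
  have ht1 : 1 ≤ t := le_trans (le_max_right _ _) ((le_max_left _ _).trans ht)
  have htε : 2 * (R + |t₀|) / ε ≤ t := (le_max_right _ _).trans ht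
  have hεt : 2 * (R + |t₀|) ≤ ε * t := by
    have h := (div_le_iff₀ hε).1 htε
    linarith [mul_comm t ε]
  -- the region is a closed ball
  have hset : {y : EuclideanSpace ℝ (Fin 3) | ‖y‖ ≤ R + (1 - ε) * t} =
      closedBall (0 : EuclideanSpace ℝ (Fin 3)) (R + (1 - ε) * t) := by
    ext y
    simp
  rw [hset]
  -- continuity of the densities on the slice
  have hθc : Continuous fun y : EuclideanSpace ℝ (Fin 3) => ymEnergyDensity A (ofTimeSpace t y) := by
    have e : (fun y : EuclideanSpace ℝ (Fin 3) => ymEnergyDensity A (ofTimeSpace t y)) =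
        fun y => stressTensor B A 0 0 (ofTimeSpace t y) :=
      funext fun y => (stressTensor_zero_zero hB _).symm
    rw [e]
    exact (contDiff_stressTensor (B := B) hA 0 0).continuous.comp
      (contDiff_ofTimeSpace_right t (n := 0)).continuous
  have hJc : Continuous fun y : EuclideanSpace ℝ (Fin 3) =>
      conformalCurrent B A t₀ 0 (ofTimeSpace t y) :=
    (contDiff_conformalCurrent (B := B) hA t₀ 0).continuous.comp
      (contDiff_ofTimeSpace_right t (n := 0)).continuous
  -- pointwise: on the ball, `e ≤ 4/(ε²t²) J⁰`
  have hptw : ∀ y ∈ closedBall (0 : EuclideanSpace ℝ (Fin 3)) (R + (1 - ε) * t),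
      ymEnergyDensity A (ofTimeSpace t y) ≤
        4 / (ε ^ 2 * t ^ 2) * conformalCurrent B A t₀ 0 (ofTimeSpace t y) := by
    intro y hy
    rw [mem_closedBall, dist_zero_right] at hy
    have h1 := sq_mul_stressTensor_le_conformalCurrent_zero hB A t₀ t y
    rw [stressTensor_zero_zero hB] at h1
    have hθ := ymEnergyDensity_nonneg A (ofTimeSpace t y)
    have hgap : ε * t / 2 ≤ |t - t₀| - ‖y‖ := by
      rw [abs_of_nonneg (sub_nonneg.2 ht₀)]
      nlinarith [le_abs_self t₀, hy, norm_nonneg y]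
    have hsq : (ε * t / 2) ^ 2 ≤ (|t - t₀| - ‖y‖) ^ 2 := by
      have h0 : 0 ≤ ε * t / 2 := by positivity
      nlinarith [hgap, h0]
    have h2 : (ε * t / 2) ^ 2 * ymEnergyDensity A (ofTimeSpace t y) ≤
        conformalCurrent B A t₀ 0 (ofTimeSpace t y) :=
      (mul_le_mul_of_nonneg_right hsq hθ).trans h1
    have hpos : 0 < (ε * t / 2) ^ 2 := by positivity
    calc ymEnergyDensity A (ofTimeSpace t y)
        = (ε * t / 2) ^ 2 * ymEnergyDensity A (ofTimeSpace t y) / (ε * t / 2) ^ 2 := by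
          field_simp
      _ ≤ conformalCurrent B A t₀ 0 (ofTimeSpace t y) / (ε * t / 2) ^ 2 :=
          div_le_div_of_nonneg_right h2 hpos.le
      _ = 4 / (ε ^ 2 * t ^ 2) * conformalCurrent B A t₀ 0 (ofTimeSpace t y) := by
          field_simp
          ring
  -- integrate over the ball and use the cone bound
  have hK : IsCompact (closedBall (0 : EuclideanSpace ℝ (Fin 3)) (R + (1 - ε) * t)) :=
    isCompact_closedBall _ _
  have I1 : ∫ y in closedBall (0 : EuclideanSpace ℝ (Fin 3)) (R + (1 - ε) * t),
      ymEnergyDensity A (ofTimeSpace t y) ≤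
      ∫ y in closedBall (0 : EuclideanSpace ℝ (Fin 3)) (R + (1 - ε) * t),
        4 / (ε ^ 2 * t ^ 2) * conformalCurrent B A t₀ 0 (ofTimeSpace t y) :=
    setIntegral_mono_on (hθc.continuousOn.integrableOn_compact hK)
      ((hJc.continuousOn.integrableOn_compact hK).const_mul _) measurableSet_closedBall hptw
  have I2 := setIntegral_conformalCurrent_le hB h𝔤 hA hsol hint ht₀ (R + (1 - ε) * t)
  have hnn : 0 ≤ ∫ y in closedBall (0 : EuclideanSpace ℝ (Fin 3)) (R + (1 - ε) * t),
      ymEnergyDensity A (ofTimeSpace t y) :=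
    setIntegral_nonneg measurableSet_closedBall fun y _ => ymEnergyDensity_nonneg A _
  have ht2 : 0 < t ^ 2 := by positivity
  rw [Real.norm_of_nonneg hnn, Real.norm_of_nonneg (inv_nonneg.2 ht2.le)]
  calc ∫ y in closedBall (0 : EuclideanSpace ℝ (Fin 3)) (R + (1 - ε) * t),
        ymEnergyDensity A (ofTimeSpace t y)
      ≤ 4 / (ε ^ 2 * t ^ 2) *
          ∫ y in closedBall (0 : EuclideanSpace ℝ (Fin 3)) (R + (1 - ε) * t),
            conformalCurrent B A t₀ 0 (ofTimeSpace t y) := by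
        rwa [integral_const_mul] at I1
    _ ≤ 4 / (ε ^ 2 * t ^ 2) * C := mul_le_mul_of_nonneg_left I2 (by positivity)
    _ = 4 * C / ε ^ 2 * (t ^ 2)⁻¹ := by
        field_simp

end Generic

/-! ### The named fact -/

section SU2

/-- **Discharge of `GlasseyStraussLocalEnergyDecay` (Glassey–Strauss 1979, §4 Theorem).** For a
smooth `𝔰𝔲(2)`-valued solution `A` of the Yang–Mills equations on all of `ℝ^{1+3}` whose Cauchy
data satisfy `∫ r² e(E, H) dx < ∞` at some time, and every `R > 0`, `0 < ε ≤ 1`: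
`∫_{|x| ≤ R+(1−ε)t} [½|E|² + ½|H|²] dx = O(t⁻²)` as `t → ∞` — "all the energy of a solution
radiates out along the light cone … In particular, there are no 'classical lumps'". Obtained from
`glasseyStrauss_isBigO_of_invariantForm` with the invariant form `Re tr(Xᴴ Y)` on
`𝔰𝔲(2) ⊆ M₂(ℂ)` (`isInvariantForm_traceFormL_suAlgebra`).
[cite: GlasseyStrauss1979, §4 Theorem (p. 7)] -/
theorem GlasseyStraussLocalEnergyDecay_holds : GlasseyStraussLocalEnergyDecay := by
  intro A hval hA hsol hdata R _hR ε hε _hε1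
  obtain ⟨t₀, hint⟩ := hdata
  exact glasseyStrauss_isBigO_of_invariantForm (isInvariantForm_traceFormL_suAlgebra 2) hval hA hsol
    t₀ hint R ε hε

end SU2

end Literature.Barriers.QuantumFields
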